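import Summits.KontsevichZagierPeriods.KontsevichZagierPeriods.Theorems.HurwitzSectorComplement.Negative.FiniteRungTable
import Summits.KontsevichZagierPeriods.KontsevichZagierPeriods.Theorems.HurwitzMicroSectorsHurwitzSectorComplementStubAssemblyAuxKit
import Literature.NumberTheory.Transcendental.KZCalculusProofs

/-!
# `HurwitzSectorComplement` (stmt-KontsevichZagierPeriods-14341) — negative side, IV: pure-weight
# families are not a witness for `NormalFormPrinciple` (why the splice stub S6 cannot be obtained by
# reusing the landed sector lemmas)

The splice stub S6 `stub_spliceRemainder : ParityTowerSector → NormalFormPrinciple` of line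
`chebyshev-level-deformation` is the summit given the parity tower sector (tree
`stub_spliceRemainder_iff`, `Negative.statement_iff_parityTower_and_spliceRemainder`). This file records,
kernel-checked, why no SPLICE OF THE LANDED SECTORS can serve as the family `𝒩` of `NormalFormPrinciple`
— the refuted strengthening complementary to `Negative.FiniteRungTable` (which kills every family whose
values have FINITE `ℚ`-dimension):

* every value the line produces is of PURE WEIGHT, `a·π^w + b` with `a, b` real algebraic
  (the line's normal forms `[(0,1)^w, C + A·∏ 2/(1+xᵢ²)]`, `C, A ∈ ℚ̄ ∩ ℝ`, to which
  S5 `Assembly.red_main` reduces every member of the parity tower sector, have value `C + A(π/2)^w` by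
  the landed `Assembly.value_nf`: `value_pureWeight_of_lineNormalForm`). This value set has
  INFINITE `ℚ`-dimension (it contains every `π^w`), so `not_reduction_finiteSpan` does not apply to it;
* but it is not closed under the sums the calculus forces: `π + π^k` (`k ≥ 2`) is the value of a
  rational representation (`exists_isRational_value_eq_pi_add_pi_pow`: merge `[disc]×[ℝ⁰,1]` and
  `[disc]^k×[ℝ⁰,1]` by the tree's `exists_of_add_of_sub_of_mem_relations`) and is NEVER of pure weight
  (`pi_add_pi_pow_ne_of_isAlgebraic`: otherwise `π` is a root of the nonzero polynomial
  `X + X^k − aX^w − b` over the number field `ℚ(a,b)`, contradicting Lindemann, tree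
  `transcendental_pi_holds`);
* hence `not_reduction_pureWeight_add_finite`: NO family whose members have values in
  {pure weight} ∪ `span_ℚ S`, `S` finite, satisfies the REDUCTION half of `NormalFormPrinciple`
  (the `π + π^k`, `k ≥ 2`, would all fall in `span_ℚ S`, whence every `π^k ∈ span_ℚ (S ∪ {1, π})`,
  contradicting `not_forall_pi_pow_mem_span`); corollaries `not_normalFormPrinciple_pureWeight`,
  and, for THIS route, `not_reduction_lineNormalForms_closedRungs_add_finite` /
  `not_reduction_of_reducesTo_lineNormalForms`: the line's normal forms (equivalently anything the
  line reduces to them, i.e. the whole parity tower sector) together with BOTH closed rungs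
  (`closedRungs`: the `(2,6)` normal forms and the `(3,2)` sector) and ANY finite list of further
  constants are not a reduction target.

So a witness `𝒩` for `NormalFormPrinciple` must realise mixed-weight values such as `π + π²`: its value
set must be closed under the ring operations of periods, which no weight-graded splice of sector lemmas
is. This is a no-go about strengthenings; it refutes no route item.

References: M. Kontsevich, D. Zagier, *Periods* (2001), §1.1 eq. (1), §1.2 Conjecture 1;
F. Lindemann (1882) via A. Baker, *Transcendental Number Theory* (1975), Ch. 1 Thm 1.3.
-/

noncomputable section

namespace Summit.KontsevichZagierPeriods.Theorems.HurwitzSectorComplement.Negative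

open Set MeasureTheory Polynomial
open Literature.NumberTheory.Transcendental
open Literature.NumberTheory.Transcendental.KZ
open Summit.KontsevichZagierPeriods.KontsevichZagierPeriods.Theses.HurwitzMicroSectors (NormalFormPrinciple)

/-! ## §1 Transcendence input: `π + π^k` is never of pure weight -/

/- Throughout, a real number is *of pure weight* if it is `a·π^w + b` with `w ∈ ℕ` and `a, b` real
algebraic — the shape of every value produced on the parity tower (`ζ(w, a/L) + (−1)^w ζ(w, 1−a/L) ∈
π^w·ℚ̄`, plus an algebraic polynomial part); the predicate is written out inline
(`∃ w a b, IsAlgebraic ℚ a ∧ IsAlgebraic ℚ b ∧ x = a * π ^ w + b`) so that this file declares no definition. -/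

/-- **`π + π^k` (`k ≥ 2`) is not of pure weight**: `π + π^k = a·π^w + b` with `a, b` real algebraic
would make `π` a root of the polynomial `X + X^k − aX^w − b` over the number field `L = ℚ(a, b)`; that
polynomial is nonzero (its coefficient of `X` is `1` if `w ≠ 1`, its coefficient of `X^k` is `1` if
`w = 1`), so `π` would be algebraic over `L`, hence over `ℚ` — contradicting Lindemann (tree
`transcendental_pi_holds`). [cite: Lindemann1882, via BakerTNT1975 Ch. 1 Theorem 1.3, p. 5] -/
theorem pi_add_pi_pow_ne_of_isAlgebraic {k : ℕ} (hk : 2 ≤ k) (w : ℕ) {a b : ℝ}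
    (ha : IsAlgebraic ℚ a) (hb : IsAlgebraic ℚ b) :
    Real.pi + Real.pi ^ k ≠ a * Real.pi ^ w + b := by
  intro h
  -- the number field `L = ℚ(a, b)`
  let L : IntermediateField ℚ ℝ := IntermediateField.adjoin ℚ {a, b}
  have haL : a ∈ L := IntermediateField.subset_adjoin ℚ _ (by simp)
  have hbL : b ∈ L := IntermediateField.subset_adjoin ℚ _ (by simp)
  haveI : FiniteDimensional ℚ L := by
    refine IntermediateField.finiteDimensional_adjoin fun x hx => ?_
    simp only [Set.mem_insert_iff, Set.mem_singleton_iff] at hx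
    rcases hx with rfl | rfl
    exacts [ha.isIntegral, hb.isIntegral]
  -- the polynomial `X + X^k − a X^w − b ∈ L[X]` annihilates `π`
  let P : Polynomial L := X + X ^ k - C (⟨a, haL⟩ : L) * X ^ w - C (⟨b, hbL⟩ : L)
  have hPeval : Polynomial.aeval Real.pi P = 0 := by
    have e1 : algebraMap L ℝ ⟨a, haL⟩ = a := rfl
    have e2 : algebraMap L ℝ ⟨b, hbL⟩ = b := rfl
    simp only [P, map_sub, map_add, map_mul, Polynomial.aeval_X, Polynomial.aeval_X_pow,
      Polynomial.aeval_C, e1, e2]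
    linarith
  -- and it is nonzero
  have hk1 : (1 : ℕ) ≠ k := by omega
  have hk0 : k ≠ 0 := by omega
  have hP0 : P ≠ 0 := by
    intro h0
    by_cases hw : w = 1
    · -- coefficient of `X^k`
      have hc := congrArg (fun p : Polynomial L => p.coeff k) h0
      simp only [P, hw, pow_one, Polynomial.coeff_sub, Polynomial.coeff_add, Polynomial.coeff_X,
        Polynomial.coeff_X_pow, Polynomial.coeff_C_mul, Polynomial.coeff_C, Polynomial.coeff_zero,
        hk1, hk0, if_false, if_true] at hc
      simp at hc
    · -- coefficient of `X`
      have hc := congrArg (fun p : Polynomial L => p.coeff 1) h0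
      have hw' : (1 : ℕ) ≠ w := fun e => hw e.symm
      simp only [P, Polynomial.coeff_sub, Polynomial.coeff_add, Polynomial.coeff_X,
        Polynomial.coeff_X_pow, Polynomial.coeff_C_mul, Polynomial.coeff_C, Polynomial.coeff_zero,
        hk1, hw', if_false, if_true] at hc
      simp at hc
  have halg : IsAlgebraic L Real.pi := ⟨P, hP0, hPeval⟩
  have hint : IsIntegral ℚ Real.pi := isIntegral_trans Real.pi halg.isIntegral
  exact transcendental_pi_holds hint.isAlgebraic

/-! ## §2 The witnesses: rational representations of value `π + π^k` -/

/-- **For every `k`, some rational representation has value `π + π^k`**: merge `piPow 1 = [disc]×[ℝ⁰,1]`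
and `piPow k = [disc]^k×[ℝ⁰,1]` into one representation modulo moves (tree
`IntegralRep.exists_of_add_of_sub_of_mem_relations`: slabs at disjoint levels glued by domain
additivity), pass to a rational representative (tree `exists_isRational_equivalent_holds`), and read
the value off by soundness (`relations_le_ker_eval_holds`, `Equivalent.value_eq_holds`, `piPow_value`).
[cite: KontsevichZagier2001, §1.1 eq. (1)] -/
theorem exists_isRational_value_eq_pi_add_pi_pow (k : ℕ) :
    ∃ (n : ℕ) (r : IntegralRep n), r.IsRational ∧ r.value = Real.pi + Real.pi ^ k := by
  obtain ⟨N, R, hR⟩ := (piPow 1).2.exists_of_add_of_sub_of_mem_relations (piPow k).2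
  obtain ⟨n, r, hr, hRr⟩ := exists_isRational_equivalent_holds R
  refine ⟨n, r, hr, ?_⟩
  have h0 := relations_le_ker_eval_holds hR
  rw [AddMonoidHom.mem_ker, map_sub, map_add, eval_of, eval_of, eval_of, piPow_value, piPow_value,
    pow_one, sub_eq_zero] at h0
  rw [← Equivalent.value_eq_holds hRr, ← h0]

/-! ## §3 The no-go: pure weight plus finite span is not a reduction target -/

/-- **No reduction to a pure-weight-plus-finite-span family.** If every member of `𝒩` has value either
of pure weight (`a·π^w + b`, `a, b ∈ ℚ̄ ∩ ℝ`) or in `span_ℚ S` for a fixed finite `S`, then not every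
rational representation is KZ-equivalent to a member of `𝒩`: the witnesses of value `π + π^k`
(`k ≥ 2`) reduce to members of value `π + π^k` (soundness), never of pure weight
(`pi_add_pi_pow_ne_of_isAlgebraic`), so all `π + π^k ∈ span_ℚ S`, whence every power of `π` lies in
`span_ℚ (S ∪ {1, π})` — contradicting `not_forall_pi_pow_mem_span` (Lindemann). [folklore] -/
theorem not_reduction_pureWeight_add_finite (𝒩 : (n : ℕ) → Set (IntegralRep n)) {S : Set ℝ}
    (hS : S.Finite)
    (hval : ∀ n (N : IntegralRep n), N ∈ 𝒩 n →
      (∃ (w : ℕ) (a b : ℝ), IsAlgebraic ℚ a ∧ IsAlgebraic ℚ b ∧ N.value = a * Real.pi ^ w + b) ∨ N.value ∈ Submodule.span ℚ S)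
    (hred : ∀ (n : ℕ) (r : IntegralRep n), r.IsRational →
      ∃ (m : ℕ) (N : IntegralRep m), N ∈ 𝒩 m ∧ Equivalent r N) : False := by
  -- every `π + π^k`, `k ≥ 2`, lies in `span_ℚ S`
  have key : ∀ k, 2 ≤ k → Real.pi + Real.pi ^ k ∈ Submodule.span ℚ S := by
    intro k hk
    obtain ⟨n, r, hr, hv⟩ := exists_isRational_value_eq_pi_add_pi_pow k
    obtain ⟨m, N, hN, hrN⟩ := hred n r hr
    have hNv : N.value = Real.pi + Real.pi ^ k := by rw [← hv, Equivalent.value_eq_holds hrN]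
    rcases hval m N hN with ⟨w, a, b, ha, hb, hab⟩ | hmem
    · exact absurd (hNv.symm.trans hab) (pi_add_pi_pow_ne_of_isAlgebraic hk w ha hb)
    · exact hNv ▸ hmem
  -- hence all powers of `π` lie in `span_ℚ (S ∪ {1, π})`
  refine not_forall_pi_pow_mem_span (S := S ∪ {1, Real.pi}) (hS.union (Set.toFinite _)) fun k => ?_
  have h1 : (1 : ℝ) ∈ Submodule.span ℚ (S ∪ {1, Real.pi}) := Submodule.subset_span (by simp)
  have hpi : Real.pi ∈ Submodule.span ℚ (S ∪ {1, Real.pi}) := Submodule.subset_span (by simp)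
  rcases Nat.lt_or_ge k 2 with hk | hk
  · interval_cases k
    · simpa using h1
    · simpa using hpi
  · have hmem : Real.pi + Real.pi ^ k ∈ Submodule.span ℚ (S ∪ {1, Real.pi}) :=
      Submodule.span_mono Set.subset_union_left (key k hk)
    have := Submodule.sub_mem _ hmem hpi
    rwa [add_sub_cancel_left] at this

/-- **The strengthened normal-form principle is FALSE for pure-weight families**: there is no
normal-form family whose values are of pure weight or in a fixed finite-dimensional `ℚ`-span and which
satisfies rigidity and reduction (rigidity is not even used). [folklore] -/
theorem not_normalFormPrinciple_pureWeight :
    ¬ ∃ (𝒩 : (n : ℕ) → Set (IntegralRep n)) (S : Set ℝ), S.Finite ∧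
      (∀ n (N : IntegralRep n), N ∈ 𝒩 n →
        (∃ (w : ℕ) (a b : ℝ), IsAlgebraic ℚ a ∧ IsAlgebraic ℚ b ∧ N.value = a * Real.pi ^ w + b) ∨ N.value ∈ Submodule.span ℚ S) ∧
      (∀ (n m : ℕ) (N : IntegralRep n) (N' : IntegralRep m), N ∈ 𝒩 n → N' ∈ 𝒩 m →
        N.value = N'.value → Equivalent N N') ∧
      (∀ (n : ℕ) (r : IntegralRep n), r.IsRational →
        ∃ (m : ℕ) (N : IntegralRep m), N ∈ 𝒩 m ∧ Equivalent r N) :=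
  fun ⟨𝒩, _, hS, hval, _, hred⟩ => not_reduction_pureWeight_add_finite 𝒩 hS hval hred

/-- A reducing family must take a MIXED-WEIGHT value outside any prescribed finite span: for every
finite `S` some member has value neither of pure weight nor in `span_ℚ S`. [folklore] -/
theorem reduction_values_escape_pureWeight (𝒩 : (n : ℕ) → Set (IntegralRep n))
    (hred : ∀ (n : ℕ) (r : IntegralRep n), r.IsRational →
      ∃ (m : ℕ) (N : IntegralRep m), N ∈ 𝒩 m ∧ Equivalent r N)
    {S : Set ℝ} (hS : S.Finite) :
    ∃ (n : ℕ) (N : IntegralRep n), N ∈ 𝒩 n ∧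
      (¬ ∃ (w : ℕ) (a b : ℝ), IsAlgebraic ℚ a ∧ IsAlgebraic ℚ b ∧ N.value = a * Real.pi ^ w + b) ∧
      N.value ∉ Submodule.span ℚ S := by
  by_contra h
  push Not at h
  exact not_reduction_pureWeight_add_finite 𝒩 hS (fun n N hN => by
    by_cases hp : ∃ (w : ℕ) (a b : ℝ), IsAlgebraic ℚ a ∧ IsAlgebraic ℚ b ∧ N.value = a * Real.pi ^ w + b
    · exact Or.inl hp
    · exact Or.inr (h n N hN fun w a b ha hb hab => hp ⟨w, a, b, ha, hb, hab⟩)) hred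

/-! ## §4 This route: the line's normal forms spliced with both closed rungs -/

/-- **Values of the line's normal forms are of pure weight.** A representation on the open box
`(0,1)^w` with integrand `C + A·∏ᵢ 2/(1+xᵢ²)` there, `C, A` real algebraic — the target of S5's
reduction `Assembly.red_main` of the parity tower sector — has value `C + A(π/2)^w = (A/2^w)·π^w + C`
(landed `Assembly.value_nf`). [cite: KontsevichZagier2001, §1.1] -/
theorem value_pureWeight_of_lineNormalForm {w : ℕ} {C A : ℝ} (hC : IsAlgebraic ℚ C)
    (hA : IsAlgebraic ℚ A) (n : IntegralRep w) (hnd : n.domain = KZ.unitCube w)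
    (hni : ∀ x ∈ KZ.unitCube w, n.integrand x = C + A * ∏ i, 2 / (1 + (x i) ^ 2)) :
    ∃ (w' : ℕ) (a b : ℝ), IsAlgebraic ℚ a ∧ IsAlgebraic ℚ b ∧ n.value = a * Real.pi ^ w' + b := by
  have h2 : IsAlgebraic ℚ ((2 : ℝ) ^ w)⁻¹ :=
    (by simpa using isAlgebraic_nat (R := ℚ) (A := ℝ) 2 : IsAlgebraic ℚ (2 : ℝ)).pow w |>.inv
  refine ⟨w, A * ((2 : ℝ) ^ w)⁻¹, C, hA.mul h2, hC, ?_⟩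
  rw [Summit.KontsevichZagierPeriods.Theorems.HurwitzMicroSectorsHurwitzSectorComplement.Assembly.value_nf
    n hnd hni, div_pow]
  ring

/-- Anything KZ-equivalent to a line normal form has pure-weight value (soundness) — in particular every
member of the parity tower sector, once S5's `Assembly.red_main` has reduced it. [folklore] -/
theorem value_pureWeight_of_equivalent_lineNormalForm {m w : ℕ} {N : IntegralRep m} {C A : ℝ}
    (hC : IsAlgebraic ℚ C) (hA : IsAlgebraic ℚ A) (n : IntegralRep w) (hnd : n.domain = KZ.unitCube w)
    (hni : ∀ x ∈ KZ.unitCube w, n.integrand x = C + A * ∏ i, 2 / (1 + (x i) ^ 2))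
    (h : Equivalent N n) :
    ∃ (w' : ℕ) (a b : ℝ), IsAlgebraic ℚ a ∧ IsAlgebraic ℚ b ∧ N.value = a * Real.pi ^ w' + b := by
  rw [Equivalent.value_eq_holds h]
  exact value_pureWeight_of_lineNormalForm hC hA n hnd hni

/-- **The line's normal forms + both closed rungs + any finite list of further constants are NOT a
reduction target**: some rational representation is KZ-equivalent to no line normal form
`[(0,1)^w, C + A·∏ 2/(1+xᵢ²)]` (any `w`, `C, A ∈ ℚ̄ ∩ ℝ`), to no `(2,6)` normal form, to no member of the
`(3,2)` sector (`closedRungs`), and to no member of any further family `ℳ` with values in the span of a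
finite list `T` (Catalan's `G`, `π⁴`, `L(4,χ₋₃)`, `ζ(5)`, …). So reusing the landed sector lemmas cannot
produce the family `𝒩` of `NormalFormPrinciple`, i.e. cannot prove the splice stub S6. [folklore] -/
theorem not_reduction_lineNormalForms_closedRungs_add_finite (ℳ : (n : ℕ) → Set (IntegralRep n))
    {T : Set ℝ} (hT : T.Finite) (hℳ : ∀ n (N : IntegralRep n), N ∈ ℳ n → N.value ∈ Submodule.span ℚ T) :
    ¬ ∀ (n : ℕ) (r : IntegralRep n), r.IsRational →
      ∃ (m : ℕ) (N : IntegralRep m),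
        N ∈ {n' : IntegralRep m | ∃ C A : ℝ, IsAlgebraic ℚ C ∧ IsAlgebraic ℚ A ∧
              n'.domain = KZ.unitCube m ∧
              ∀ x ∈ KZ.unitCube m, n'.integrand x = C + A * ∏ i, 2 / (1 + (x i) ^ 2)} ∪
            closedRungs m ∪ ℳ m ∧
        Equivalent r N := by
  intro hred
  refine not_reduction_pureWeight_add_finite (fun m =>
      {n' : IntegralRep m | ∃ C A : ℝ, IsAlgebraic ℚ C ∧ IsAlgebraic ℚ A ∧ n'.domain = KZ.unitCube m ∧
        ∀ x ∈ KZ.unitCube m, n'.integrand x = C + A * ∏ i, 2 / (1 + (x i) ^ 2)} ∪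
      closedRungs m ∪ ℳ m)
    (S := ({1, Real.pi ^ 2, L2chi3, zetaValue 3} : Set ℝ) ∪ T) ((Set.toFinite _).union hT) ?_ hred
  rintro n N ((⟨C, A, hC, hA, hnd, hni⟩ | hN) | hN)
  · exact Or.inl (value_pureWeight_of_lineNormalForm hC hA N hnd hni)
  · exact Or.inr (Submodule.span_mono Set.subset_union_left (value_mem_span_of_mem_closedRungs hN))
  · exact Or.inr (Submodule.span_mono Set.subset_union_right (hℳ n N hN))

/-- **… nor is any family the line REDUCES to its normal forms** (e.g. the whole parity tower sector
`[(0,1)^w, Q(t) + R(t)/(1−t^N)]`, `Q, R ∈ (ℚ̄ ∩ ℝ)[t]`, `R` `(−1)^w`-symmetric, via S5 `Assembly.red_main`),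
spliced with both closed rungs and any finite-span family: still not a reduction target. [folklore] -/
theorem not_reduction_of_reducesTo_lineNormalForms (F ℳ : (n : ℕ) → Set (IntegralRep n))
    (hF : ∀ n (N : IntegralRep n), N ∈ F n →
      ∃ (w : ℕ) (C A : ℝ) (n' : IntegralRep w), IsAlgebraic ℚ C ∧ IsAlgebraic ℚ A ∧
        n'.domain = KZ.unitCube w ∧
        (∀ x ∈ KZ.unitCube w, n'.integrand x = C + A * ∏ i, 2 / (1 + (x i) ^ 2)) ∧ Equivalent N n')
    {T : Set ℝ} (hT : T.Finite) (hℳ : ∀ n (N : IntegralRep n), N ∈ ℳ n → N.value ∈ Submodule.span ℚ T) :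
    ¬ ∀ (n : ℕ) (r : IntegralRep n), r.IsRational →
      ∃ (m : ℕ) (N : IntegralRep m), N ∈ F m ∪ closedRungs m ∪ ℳ m ∧ Equivalent r N := by
  intro hred
  refine not_reduction_pureWeight_add_finite (fun m => F m ∪ closedRungs m ∪ ℳ m)
    (S := ({1, Real.pi ^ 2, L2chi3, zetaValue 3} : Set ℝ) ∪ T) ((Set.toFinite _).union hT) ?_ hred
  rintro n N ((hN | hN) | hN)
  · obtain ⟨w, C, A, n', hC, hA, hnd, hni, hNn'⟩ := hF n N hN
    exact Or.inl (value_pureWeight_of_equivalent_lineNormalForm hC hA n' hnd hni hNn')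
  · exact Or.inr (Submodule.span_mono Set.subset_union_left (value_mem_span_of_mem_closedRungs hN))
  · exact Or.inr (Submodule.span_mono Set.subset_union_right (hℳ n N hN))

end Summit.KontsevichZagierPeriods.Theorems.HurwitzSectorComplement.Negative

end
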